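import Summits.QuantumFields.BalabanUV.T4Continuum.Support.DirichletStarRenormTower
import Summits.QuantumFields.BalabanUV.T4Continuum.Support.ScalarBlockPoincareLocal

/-!
# T⁴ programme, spine node NE2 (U1a), sub-row Δ1 «NE2⁰-Dirichlet» — THE SIBLING CLASSES OF THE STAR CARRIERS (supplier item
# «Δ1-VEC-CLASS-POINCARÉ», owner rulings R27 (b) / R28 (c), file 1 of 2): the classes of the renormalised pairing `J̃` on the star
# bonds are FULL `L`-blocks (parent site in `Ω_k`) and last-`ν`-LAYERS (inward boundary parents), both charted from the cube
# `Fin d → Fin L`; in-cube bonds are interior star bonds; the cube Poincaré brick with the `d`-FREE constant `(L−1)L/2`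

NE2 formalisation swarm `b2b-balaban-t4-ne2-formalise-*`, LEAF PROVER 07 (gen 7), on the owner's (t4-ne2-p1 gen 13) files 4/5
`Support/DirichletSubregionRenormTower` (p228571: `nch`, the renormalised injection `JnR`) and `Support/DirichletStarRenormTower`
(p228905: the interior difference `igrad`, `poincareForm_of_sockets`).  There the Poincaré-form bound PF of the defect-free star tower
was split into two SOCKETS: a CLASS POINCARÉ inequality on the sibling classes of the star carriers (lattice geometry; «NOT in the
tree») × an INTERIOR gradient-form bound (open).  This file and file 2 `Support/DirichletStarClassPoincare` prove the first socket for
every `d`, `L ≥ 1`, torus, region `S` and level `k`.  THIS FILE (geometry and bookkeeping only):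

 * §1 the cube brick on `Fin d → Fin L` (**`cube_poincare`**): the tree's tensorised in-box Poincaré inequality
   `ScalarBlockPoincareLocal.sum_norm_sub_mean_sq_le_cube` (leaf-01-g4; complex values, `d`-FREE constant `(L−1)L/2`, read off
   `Beta.CoordCubePoincare.poincare_coordCube`) restated with the successor `bump` and the filter `j_μ + 1 < L`;
 * §2 the sibling classes: the children of a coarse bond `(x, ν)` are `child (x,ν) j = (L·x + j, ν)`, `j : Fin d → Fin L`
   (`parT_child`, `child_rem`, `child_inj`); a child is a star bond iff `x ∈ Ω_k`, or `j_ν + 1 = L` and `x + e_ν ∈ Ω_k`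
   (**`star_child_iff`**: `blockReg_par_iff`, `par_add_unitVec`, `face_cpt_add_off_iff`).  So the class `cls i` of a star parent `i`
   (cardinality = the owner's `nch`, `card_cls`) is charted from the FULL cube: **`chart i j = child i (adj i j)`**, `adj = id` if
   `x ∈ Ω_k` (the class is the full `L`-block) and `adj j = j[ν ↦ L−1]` otherwise (the class is the last `ν`-layer, each member hit
   `L` times): `chart_eq_iff`, **`card_fibre`** (`= mult i ∈ {1, L}`), **`sum_chart`** (`Σ_j G (chart i j) = mult i • Σ_{cls i} G`),
   `card_cube` (`L^d = mult i · nch i`); in-cube bonds `bump j μ` (`j_μ + 1 < L`) are interior star bonds — **`chart_bump_fst`**: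
   `chart i (bump j μ) = chart i j + e_μ` (`off_bump`) — except the `μ = ν` bonds of a layer chart, along which the chart is
   constant (`adj_bump_deg`).

HONEST FRAMING (T4-DAG p. 1).  Lattice geometry at MODEL level (`U = 1`, ONE region, finite torus); statements / conventions OURS
([folklore]); nothing analytic is discharged here (file 2 discharges ONE of PF's two sockets; interior W2, W1 uniformly in the region
and W3̃ stay DISPLAYED); NE2 (U1a) NOT proved; spine 0/9 unchanged; NOT [B9] (3.16)/(3.23)–(3.27) as printed; NOT infinite volume,
NOT a mass gap, NOT the Clay problem, NOT summit progress.  HONEST DEPENDENCY: continuum YM on T⁴ ⇐ BetaPertH ∧ nine spine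
estimates (0/9 proved); BetaPertH ⇐ (D1) ∧ (D4) ∧ CAP+tail; G-an2-4 gates asym, D1 and NE2/3/4.  No `sorry`.
-/

noncomputable section

open scoped BigOperators ComplexConjugate Matrix Matrix.Norms.L2Operator
open Finset

namespace Summit.QuantumFields.BalabanUV.T4Continuum.DirichletStarSiblingClasses

open Literature.MathematicalPhysics.QuantumFieldTheory.Balaban1983to89.B5Prop11Plancherel (Tor fine unitVec)
open Literature.MathematicalPhysics.QuantumFieldTheory.Balaban1983to89.B5G183RateUnitTower (lev)
open Literature.MathematicalPhysics.QuantumFieldTheory.Balaban1983to89.B5G183RateTorus (cpt)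
open Literature.MathematicalPhysics.QuantumFieldTheory.Balaban1983to89.B5G183RateTorusW (off)
open Literature.MathematicalPhysics.QuantumFieldTheory.Balaban1983to89.Beta.CoordCubePoincare (stepUp)
open Summit.QuantumFields.BalabanUV.T4Continuum
open Summit.QuantumFields.BalabanUV.T4Continuum.BalabanAveragedTowerUnit (idx)
open Summit.QuantumFields.BalabanUV.T4Continuum.BalabanAveragedTowerModes (par rem par_cpt_add_off rem_cpt_add_off
  cpt_par_add_off_rem)
open Summit.QuantumFields.BalabanUV.T4Continuum.BlockPairingGeometry (parT par_add_unitVec face_cpt_add_off_iff)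
open Summit.QuantumFields.BalabanUV.T4Continuum.RegionGaugeFixedVector (starReg)
open Summit.QuantumFields.BalabanUV.T4Continuum.DirichletSubregionTowerOf (pidx)
open Summit.QuantumFields.BalabanUV.T4Continuum.DirichletSubregionRenormTower (nch)
open Summit.QuantumFields.BalabanUV.T4Continuum.DirichletStarVectorTower (starP blockReg_par_iff)
open Summit.QuantumFields.BalabanUV.T4Continuum.ScalarBlockPoincareLocal (sum_norm_sub_mean_sq_le_cube)
open Summit.QuantumFields.BalabanUV.Beta.GAN24.DirichletBoxTrace (blockReg)

variable {d : ℕ}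

/-! ## §1 The cube brick on `Fin d → Fin L` -/

section Cube

variable (L : ℕ) [NeZero L]

/-- one step up in direction `μ` on the cube `Fin d → Fin L` (`Fin` addition; only used off the last `μ`-layer). [folklore] -/
def bump (j : Fin d → Fin L) (μ : Fin d) : Fin d → Fin L := Function.update j μ (j μ + 1)

/-- the last digit `L − 1`. [folklore] -/
def lastF : Fin L := ⟨L - 1, Nat.sub_lt (Nat.pos_of_ne_zero (NeZero.ne L)) one_pos⟩

/-- off the last layer the bumped digit is `j_μ + 1`. [folklore] -/
theorem val_bump_self (j : Fin d → Fin L) (μ : Fin d) (h : (j μ : ℕ) + 1 < L) :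
    ((bump L j μ μ : Fin L) : ℕ) = (j μ : ℕ) + 1 := by
  obtain ⟨n, rfl⟩ : ∃ n, L = n + 1 := ⟨L - 1, (Nat.succ_pred_eq_of_ne_zero (NeZero.ne L)).symm⟩
  rw [bump, Function.update_self]
  exact Fin.val_add_one_of_lt (by rw [Fin.lt_def, Fin.val_last]; omega)

/-- the other digits are untouched. [folklore] -/
theorem bump_apply_of_ne (j : Fin d → Fin L) {μ ν : Fin d} (h : ν ≠ μ) : bump L j μ ν = j ν := by
  rw [bump, Function.update_of_ne h]

omit [NeZero L] in
/-- a digit `t < L` is on the far face (`L ∣ t + 1`) iff `t + 1 = L`. [folklore] -/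
theorem dvd_succ_iff (t : Fin L) : L ∣ (t : ℕ) + 1 ↔ (t : ℕ) + 1 = L := by
  constructor
  · intro h
    have h1 := Nat.le_of_dvd (Nat.succ_pos _) h
    have h2 := t.isLt
    omega
  · intro h; rw [h]

/-- **THE CUBE POINCARÉ INEQUALITY** (the tree's `ScalarBlockPoincareLocal.sum_norm_sub_mean_sq_le_cube`, restated on `Fin d → Fin L`):
`Σ_j ‖F j − mean F‖² ≤ ((L−1)L/2)·Σ_μ Σ_{j : j_μ + 1 < L} ‖F (bump j μ) − F j‖²`, constant free of `d`. [folklore] -/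
theorem cube_poincare (d : ℕ) (F : (Fin d → Fin L) → ℂ) :
    ∑ j, ‖F j - (∑ j, F j) / (Fintype.card (Fin d → Fin L) : ℂ)‖ ^ 2
      ≤ ((L : ℝ) - 1) * L / 2 * ∑ μ : Fin d, ∑ j ∈ univ.filter (fun j : Fin d → Fin L => (j μ : ℕ) + 1 < L),
          ‖F (bump L j μ) - F j‖ ^ 2 := by
  obtain ⟨n, rfl⟩ : ∃ n, L = n + 1 := ⟨L - 1, (Nat.succ_pred_eq_of_ne_zero (NeZero.ne L)).symm⟩
  have h := sum_norm_sub_mean_sq_le_cube n d F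
  have hfilt : ∀ μ : Fin d, univ.filter (fun j : Fin d → Fin (n + 1) => j μ ≠ Fin.last n)
      = univ.filter (fun j : Fin d → Fin (n + 1) => (j μ : ℕ) + 1 < n + 1) := by
    intro μ; ext j
    simp only [mem_filter, mem_univ, true_and, ← Fin.lt_last_iff_ne_last, Fin.lt_def, Fin.val_last]
    omega
  have hsum : ∀ μ : Fin d,
      ∑ j ∈ univ.filter (fun j : Fin d → Fin (n + 1) => j μ ≠ Fin.last n), ‖F (stepUp j μ) - F j‖ ^ 2
        = ∑ j ∈ univ.filter (fun j : Fin d → Fin (n + 1) => (j μ : ℕ) + 1 < n + 1), ‖F (bump (n + 1) j μ) - F j‖ ^ 2 :=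
    fun μ => sum_congr (hfilt μ) fun j _ => rfl
  rw [sum_congr rfl fun μ _ => hsum μ] at h
  refine h.trans (le_of_eq ?_)
  congr 1
  push_cast
  ring

end Cube

/-! ## §2 The sibling classes of the star carriers: children, star membership, the chart and its fibres -/

section Children

variable (L : ℕ) [NeZero L] (M : Fin d → ℕ) [hM : ∀ μ, NeZero (M μ)]

omit hM in
/-- an in-block bond on the fine lattice: `off (bump j μ) = off j + e_μ` when `j_μ + 1 < L`. [folklore] -/
theorem off_bump {N : ℕ} [NeZero N] (j : Fin d → Fin L) (μ : Fin d) (h : (j μ : ℕ) + 1 < L) :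
    off N L M (bump L j μ) = off N L M j + unitVec (fine (L * N) M) μ := by
  funext ν
  simp only [off, Pi.add_apply, unitVec]
  by_cases hν : ν = μ
  · subst hν
    rw [Pi.single_eq_same, val_bump_self L j ν h, Nat.cast_add, Nat.cast_one]
  · rw [Pi.single_eq_of_ne hν, add_zero, bump_apply_of_ne L j hν]

/-- the level-`(k+1)` CHILD of the coarse bond `b = (x, ν)` at cube position `j`: `(L·x + j, ν)`. [folklore] -/
def child (k : ℕ) (b : idx L M k) (j : Fin d → Fin L) : Tor (fine (L * lev L k) M) × Fin d :=
  (cpt (lev L k) L M b.1 + off (lev L k) L M j, b.2)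

/-- its parent is `b`. [folklore] -/
theorem parT_child (k : ℕ) (b : idx L M k) (j : Fin d → Fin L) : parT (lev L k) L M (child L M k b j) = b := by
  unfold child parT
  rw [par_cpt_add_off]

/-- every fine bond is the child of its parent at its own offset. [folklore] -/
theorem child_rem (k : ℕ) (y : idx L M (k + 1)) : child L M k (parT (lev L k) L M y) (rem (lev L k) L M y.1) = y :=
  Prod.ext (cpt_par_add_off_rem (lev L k) L M y.1) rfl

/-- the cube position is determined by the child. [folklore] -/
theorem child_inj (k : ℕ) (b : idx L M k) {j j' : Fin d → Fin L} (h : child L M k b j = child L M k b j') : j = j' := by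
  have h1 := congrArg (fun z : Tor (fine (L * lev L k) M) × Fin d => rem (lev L k) L M z.1) h
  simpa only [child, rem_cpt_add_off] using h1

variable (S : Tor M → Prop) [DecidablePred S]

omit [DecidablePred S] in
/-- a child site lies in `Ω_{k+1}` iff the parent site lies in `Ω_k`. [folklore] -/
theorem blockReg_child_iff (k : ℕ) (b : idx L M k) (j : Fin d → Fin L) :
    blockReg (lev L (k + 1)) M S (child L M k b j).1 ↔ blockReg (lev L k) M S b.1 := by
  rw [← blockReg_par_iff L M S k]
  unfold child
  rw [par_cpt_add_off]

omit [DecidablePred S] in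
/-- the `+e_ν`-shifted child site lies in `Ω_{k+1}` iff (`j_ν + 1 = L` and `x + e_ν ∈ Ω_k`) or (`j_ν + 1 < L` and `x ∈ Ω_k`). [folklore] -/
theorem blockReg_child_add_iff (k : ℕ) (b : idx L M k) (j : Fin d → Fin L) :
    blockReg (lev L (k + 1)) M S ((child L M k b j).1 + unitVec (fine (L * lev L k) M) b.2)
      ↔ (if (j b.2 : ℕ) + 1 = L then blockReg (lev L k) M S (b.1 + unitVec (fine (lev L k) M) b.2)
          else blockReg (lev L k) M S b.1) := by
  rw [← blockReg_par_iff L M S k]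
  unfold child
  simp only
  rw [par_add_unitVec]
  by_cases h : (j b.2 : ℕ) + 1 = L
  · have hd : L ∣ ((cpt (lev L k) L M b.1 + off (lev L k) L M j) b.2).val + 1 :=
      (face_cpt_add_off_iff (lev L k) L M b.2 b.1 j).mpr ((dvd_succ_iff L (j b.2)).mpr h)
    rw [if_pos hd, if_pos h, par_cpt_add_off]
  · have hd : ¬ L ∣ ((cpt (lev L k) L M b.1 + off (lev L k) L M j) b.2).val + 1 :=
      fun hd => h ((dvd_succ_iff L (j b.2)).mp ((face_cpt_add_off_iff (lev L k) L M b.2 b.1 j).mp hd))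
    rw [if_neg hd, if_neg h, par_cpt_add_off]

omit [DecidablePred S] in
/-- **STAR MEMBERSHIP OF A CHILD**: `(L·x + j, ν)` is a star bond iff `x ∈ Ω_k`, or `j_ν + 1 = L` and `x + e_ν ∈ Ω_k`. [folklore] -/
theorem star_child_iff (k : ℕ) (b : idx L M k) (j : Fin d → Fin L) :
    starP L M S (k + 1) (child L M k b j) ↔
      blockReg (lev L k) M S b.1 ∨ ((j b.2 : ℕ) + 1 = L ∧ blockReg (lev L k) M S (b.1 + unitVec (fine (lev L k) M) b.2)) := by
  show blockReg (lev L (k + 1)) M S (child L M k b j).1 ∨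
      blockReg (lev L (k + 1)) M S ((child L M k b j).1 + unitVec (fine (L * lev L k) M) (child L M k b j).2) ↔ _
  rw [blockReg_child_iff, show (child L M k b j).2 = b.2 from rfl, blockReg_child_add_iff]
  by_cases h : (j b.2 : ℕ) + 1 = L
  · rw [if_pos h]; simp only [h, true_and]
  · rw [if_neg h]; simp only [h, false_and, or_false, or_self]

/-- the cube coordinates ADJUSTED to the sibling class of a star parent `i = (x, ν)`: the identity when `x ∈ Ω_k` (class = the full
`L`-block), else pinned to the last `ν`-layer (class = that layer). [folklore] -/
def adj (k : ℕ) (i : pidx L M (starP L M S) k) (j : Fin d → Fin L) : Fin d → Fin L :=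
  if blockReg (lev L k) M S i.1.1 then j else Function.update j i.1.2 (lastF L)

/-- the multiplicity of the chart: `1` for a full block, `L` for a layer. [folklore] -/
def mult (k : ℕ) (i : pidx L M (starP L M S) k) : ℕ := if blockReg (lev L k) M S i.1.1 then 1 else L

/-- `0 < mult`. [folklore] -/
theorem mult_pos (k : ℕ) (i : pidx L M (starP L M S) k) : 0 < mult L M S k i := by
  unfold mult; split_ifs
  · exact one_pos
  · exact Nat.pos_of_ne_zero (NeZero.ne L)

/-- adjusted children are star bonds. [folklore] -/
theorem star_child_adj (k : ℕ) (i : pidx L M (starP L M S) k) (j : Fin d → Fin L) :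
    starP L M S (k + 1) (child L M k i.1 (adj L M S k i j)) := by
  rw [star_child_iff]
  unfold adj
  by_cases hx : blockReg (lev L k) M S i.1.1
  · exact Or.inl hx
  · rw [if_neg hx]
    refine Or.inr ⟨?_, i.2.resolve_left hx⟩
    rw [Function.update_self]
    show (L - 1) + 1 = L
    have := Nat.pos_of_ne_zero (NeZero.ne L)
    omega

/-- **THE CHART** of the sibling class of the star parent `i` from the full cube `Fin d → Fin L`. [folklore] -/
def chart (k : ℕ) (i : pidx L M (starP L M S) k) (j : Fin d → Fin L) : pidx L M (starP L M S) (k + 1) :=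
  ⟨child L M k i.1 (adj L M S k i j), star_child_adj L M S k i j⟩

/-- **THE SIBLING CLASS** of `i`: the star children of the coarse bond `i.1` (its cardinality is the owner's `nch`). [folklore] -/
def cls (k : ℕ) (i : pidx L M (starP L M S) k) : Finset (pidx L M (starP L M S) (k + 1)) :=
  univ.filter fun y => parT (lev L k) L M y.1 = i.1

/-- `|cls i| = nch i`. [folklore] -/
theorem card_cls (k : ℕ) (i : pidx L M (starP L M S) k) : (cls L M S k i).card = nch L M (starP L M S) k i.1 := rfl

/-- the chart lands in the class. [folklore] -/
theorem chart_mem (k : ℕ) (i : pidx L M (starP L M S) k) (j : Fin d → Fin L) : chart L M S k i j ∈ cls L M S k i := by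
  simp only [cls, mem_filter, mem_univ, true_and, chart, parT_child]

/-- a class member in coordinates: `y = child i (rem y)`. [folklore] -/
theorem eq_child_rem {k : ℕ} {i : pidx L M (starP L M S) k} {y : pidx L M (starP L M S) (k + 1)} (hy : y ∈ cls L M S k i) :
    y.1 = child L M k i.1 (rem (lev L k) L M y.1.1) := by
  rw [← (mem_filter.mp hy).2, child_rem]

/-- in a LAYER class (`x ∉ Ω_k`) every member sits in the last `ν`-layer. [folklore] -/
theorem rem_eq_last {k : ℕ} {i : pidx L M (starP L M S) k} (hx : ¬ blockReg (lev L k) M S i.1.1)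
    {y : pidx L M (starP L M S) (k + 1)} (hy : y ∈ cls L M S k i) : rem (lev L k) L M y.1.1 i.1.2 = lastF L := by
  have hstar : starP L M S (k + 1) (child L M k i.1 (rem (lev L k) L M y.1.1)) := by rw [← eq_child_rem L M S hy]; exact y.2
  rw [star_child_iff] at hstar
  obtain ⟨h, -⟩ := hstar.resolve_left hx
  apply Fin.ext
  show (rem (lev L k) L M y.1.1 i.1.2 : ℕ) = L - 1
  omega

/-- THE FIBRES OF THE CHART: `chart i j = y ↔ adj i j = rem y`. [folklore] -/
theorem chart_eq_iff {k : ℕ} {i : pidx L M (starP L M S) k} {y : pidx L M (starP L M S) (k + 1)} (hy : y ∈ cls L M S k i)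
    (j : Fin d → Fin L) : chart L M S k i j = y ↔ adj L M S k i j = rem (lev L k) L M y.1.1 := by
  rw [Subtype.ext_iff]
  show child L M k i.1 (adj L M S k i j) = y.1 ↔ _
  exact ⟨fun h => child_inj L M k i.1 (h.trans (eq_child_rem L M S hy)), fun h => by rw [h]; exact (eq_child_rem L M S hy).symm⟩

/-- each class member is hit `mult i` times. [folklore] -/
theorem card_fibre {k : ℕ} {i : pidx L M (starP L M S) k} {y : pidx L M (starP L M S) (k + 1)} (hy : y ∈ cls L M S k i) :
    (univ.filter fun j : Fin d → Fin L => chart L M S k i j = y).card = mult L M S k i := by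
  set r := rem (lev L k) L M y.1.1 with hr
  have e : (univ.filter fun j : Fin d → Fin L => chart L M S k i j = y) = univ.filter fun j => adj L M S k i j = r :=
    filter_congr fun j _ => chart_eq_iff L M S hy j
  rw [e]
  unfold adj mult
  by_cases hx : blockReg (lev L k) M S i.1.1
  · simp only [if_pos hx]
    rw [Finset.filter_eq' univ r, if_pos (mem_univ r), card_singleton]
  · simp only [if_neg hx]
    have hlast : r i.1.2 = lastF L := rem_eq_last L M S hx hy
    have himg : (univ.filter fun j : Fin d → Fin L => Function.update j i.1.2 (lastF L) = r)
        = univ.image fun t : Fin L => Function.update r i.1.2 t := by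
      ext j
      simp only [mem_filter, mem_univ, true_and, mem_image]
      constructor
      · intro h
        exact ⟨j i.1.2, by rw [← h, Function.update_idem, Function.update_eq_self]⟩
      · rintro ⟨t, rfl⟩
        rw [Function.update_idem, ← hlast, Function.update_eq_self]
    rw [himg, card_image_of_injective _ (Function.update_injective r i.1.2), card_univ, Fintype.card_fin]

/-- **SUMS THROUGH THE CHART**: `Σ_j G (chart i j) = mult i • Σ_{y ∈ cls i} G y`. [folklore] -/
theorem sum_chart {β : Type*} [AddCommMonoid β] (k : ℕ) (i : pidx L M (starP L M S) k)
    (G : pidx L M (starP L M S) (k + 1) → β) :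
    ∑ j, G (chart L M S k i j) = mult L M S k i • ∑ y ∈ cls L M S k i, G y := by
  rw [← sum_fiberwise_of_maps_to (s := univ) (t := cls L M S k i) (g := chart L M S k i) (fun j _ => chart_mem L M S k i j),
    smul_sum]
  refine sum_congr rfl fun y hy => ?_
  have e : ∀ j ∈ univ.filter (fun j : Fin d → Fin L => chart L M S k i j = y), G (chart L M S k i j) = G y :=
    fun j hj => by rw [(mem_filter.mp hj).2]
  rw [sum_congr rfl e, sum_const, card_fibre L M S hy]

/-- hence `L^d = mult i · nch i`. [folklore] -/
theorem card_cube (k : ℕ) (i : pidx L M (starP L M S) k) :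
    Fintype.card (Fin d → Fin L) = mult L M S k i * nch L M (starP L M S) k i.1 := by
  have h := sum_chart L M S k i (fun _ => (1 : ℕ))
  simpa only [sum_const, card_univ, card_cls, smul_eq_mul, mul_one] using h

/-- in a LAYER chart the `ν`-bonds are degenerate: `adj (bump j ν) = adj j`. [folklore] -/
theorem adj_bump_deg {k : ℕ} {i : pidx L M (starP L M S) k} (hx : ¬ blockReg (lev L k) M S i.1.1) (j : Fin d → Fin L) :
    adj L M S k i (bump L j i.1.2) = adj L M S k i j := by
  unfold adj
  rw [if_neg hx, if_neg hx, bump, Function.update_idem]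

/-- the REGULAR in-cube bonds: off the degenerate case, `adj (bump j μ) = bump (adj j) μ` and the adjusted digit is `j_μ`. [folklore] -/
theorem adj_bump_reg {k : ℕ} {i : pidx L M (starP L M S) k} {μ : Fin d}
    (h : ¬ (¬ blockReg (lev L k) M S i.1.1 ∧ μ = i.1.2)) (j : Fin d → Fin L) :
    adj L M S k i (bump L j μ) = bump L (adj L M S k i j) μ ∧ adj L M S k i j μ = j μ := by
  unfold adj
  by_cases hx : blockReg (lev L k) M S i.1.1
  · rw [if_pos hx, if_pos hx]; exact ⟨rfl, rfl⟩
  · have hne : μ ≠ i.1.2 := fun e => h ⟨hx, e⟩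
    rw [if_neg hx, if_neg hx]
    refine ⟨?_, Function.update_of_ne hne _ _⟩
    rw [bump, bump, Function.update_comm hne, Function.update_of_ne hne]

/-- **IN-CUBE BONDS ARE INTERIOR STAR BONDS**: off the degenerate case and off the last `μ`-layer, the chart of `bump j μ` is the
`+e_μ` neighbour of the chart of `j`. [folklore] -/
theorem chart_bump_fst {k : ℕ} {i : pidx L M (starP L M S) k} {μ : Fin d}
    (h : ¬ (¬ blockReg (lev L k) M S i.1.1 ∧ μ = i.1.2)) {j : Fin d → Fin L} (hj : (j μ : ℕ) + 1 < L) :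
    (chart L M S k i (bump L j μ)).1 = ((chart L M S k i j).1.1 + unitVec (fine (lev L (k + 1)) M) μ, (chart L M S k i j).1.2) := by
  obtain ⟨h1, h2⟩ := adj_bump_reg L M S h j
  have hj' : ((adj L M S k i j μ : Fin L) : ℕ) + 1 < L := by rw [h2]; exact hj
  show child L M k i.1 (adj L M S k i (bump L j μ)) = _
  rw [h1]
  unfold child chart
  simp only
  rw [off_bump L M _ μ hj']
  congr 1
  exact (add_assoc _ _ _).symm

end Children

end Summit.QuantumFields.BalabanUV.T4Continuum.DirichletStarSiblingClasses

end
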